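import Summits.QuantumFields.YangMills.Theorems.FlatTubeReductionCoreTransferMomentsCS
import Summits.QuantumFields.YangMills.Theorems.FlatTubeReductionCoreDefectSlowMoments
import Summits.QuantumFields.YangMills.Theorems.LuscherReductionTwistedTraceScalingBOCoreDefectPointwise
import Summits.QuantumFields.YangMills.Theorems.LuscherReductionTwistedTraceScalingBTWindow
import Summits.QuantumFields.YangMills.Theorems.LuscherReductionRunningReductionInnerRegion
import Summits.QuantumFields.YangMills.Theorems.FlatTubeReductionOneSiteKernelOrbitMoment
import HarnessLib

/-!
# The windowed, slow-integrated Cauchy–Schwarz core defect with orbit-distance coefficients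

Support file for the crux `NearFlatRatioLaw` (line `ratepack_v2`, stub `stub_hODpot_A`, the `(C2)`-moments route of
`Cruxes/NearFlatRatioLaw/Lines/ratepack-v7-moments-g18.md`, assembly step (A1-inst)).

`…CoreTransferMomentsCS.colour_fpFibreTransfer_defect_sq_le_moments` bounds the pointwise colour-averaged core defect
`(I(u) − c_q P(x') ρ̄(u))²` with coefficients `c₀, c₁` depending on the one-site windows `δ, δu, σ`; here the windows are
chosen POINTWISE through the gauge-orbit distances `d' = orbitDist u'`, `d = orbitDist u` (`‖q(u_k) − 1‖ ≤ orbitDist u`,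
`S(u) ≤ 8·orbitDist(u)²·|P₁|`), so that `c₀ = 216βΓ·d'(d' + d)` and `c₁ = K(β A_L (d' + d) + √β/2)` are GAUGE-INVARIANT affine
functions of `orbitDist u`, and then `…CoreDefectSlowMoments.sq_slow_defect_le_colour_moments` integrates the bound against a
slow test function `φ` supported in the input window `{orbitDist ≤ d_I}` (outside the support the integrand is replaced by its
centre, where the pointwise bound is trivial).  The result `colour_defect_sq_slow_le_orbit_moments` is the `u`-integrated core
defect `(∫φ I − c_q P(x') ∫φρ̄)² ≤ (∫φ²ρ̄)·(40(1+η_c) c_q P(x')·((∫g₀ρ̄)𝒴₀ + (∫g₁ρ̄)(𝒴₁+𝒴₂) + 9c₂²(∫ρ̄)(𝒴₃+𝒴₄)) + 2η_c²(c_qP(x'))²∫ρ̄)`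
with `g₁(u) = c₁(u)²`, `g₀(u) = (c₀(u) + c₁(u)‖x'‖² + 3c₂‖x'‖⁴)²` polynomial in `orbitDist u` — the origin of the
`orbitDist(u)²φ(u)²` potential of `stub_hODpot_A` — and `𝒴_m(x') = ∫ dc T[Ω_m, W_m](c⁻¹ oT(1,v') c; 1)` the colour-averaged reweighted
central transfers.
-/

noncomputable section

open MeasureTheory Filter Topology Real
open scoped BigOperators
open Literature.MathematicalPhysics.QuantumFieldTheory
open Literature.MathematicalPhysics.QuantumLattice

namespace Summit.QuantumFields.YangMills.Theorems.FemtoTransferGap.TwoLattice.ConstTube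

open Summit.QuantumFields.YangMills.Theorems.FemtoTransferGap
open Summit.QuantumFields.YangMills.Theorems.FemtoTransferGap.TwoLattice
open Summit.QuantumFields.YangMills.Theorems.FemtoTransferGap.TwoLattice.Avg
open Summit.QuantumFields.YangMills.Theorems.FemtoTransferGap.TwoLattice.Stiff (LinkSpace)
open Summit.QuantumFields.YangMills.Theorems.FemtoTransferGap.TwoLattice.GnChart (linkCurry)

variable {L : ℕ} [NeZero L]

/-! ## §1 Small tools -/

omit [NeZero L] in
/-- `linkEmbed ∘ linkCurry = id`. [folklore] -/
theorem linkEmbed_linkCurry (x : LinkSpace L) : linkEmbed L (linkCurry x) = x := by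
  ext ea; rfl

/-- The window sum dominates the coefficient of `…CoreTransferMomentsCS`: for `0 ≤ d' ≤ 1/2`, `0 ≤ d`, `d' + d ≤ 1`,
`(d'+d) + d' + (d'+d)² + d'² + √(8P₁L³(d'² + d²)) ≤ (4 + √(8P₁L³))(d' + d)`. [folklore] -/
theorem window_sum_le {d' d P : ℝ} (hd'0 : 0 ≤ d') (hd'1 : d' ≤ 1 / 2) (hd0 : 0 ≤ d) (h1 : d' + d ≤ 1) (hP : 0 ≤ P) :
    (d' + d) + d' + (d' + d) ^ 2 + d' ^ 2 + Real.sqrt (P * (d' ^ 2 + d ^ 2)) ≤ (4 + Real.sqrt P) * (d' + d) := by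
  have hsq : Real.sqrt (P * (d' ^ 2 + d ^ 2)) ≤ Real.sqrt P * (d' + d) := by
    rw [Real.sqrt_mul hP]
    refine mul_le_mul_of_nonneg_left ?_ (Real.sqrt_nonneg _)
    rw [Real.sqrt_le_left (by linarith)]
    nlinarith
  nlinarith

/-! ## §2 The windowed slow integration -/
set_option maxHeartbeats 400000 in
/-- ★★★ **THE `u`-INTEGRATED CORE DEFECT WITH ORBIT-DISTANCE COEFFICIENTS** (see the module docstring): for an output point `u'`
with `orbitDist u' ≤ d_O ≤ 1/2`, an inner-core fibre point `x' = linkEmbed v'`, and a bounded measurable slow test function `φ`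
supported in `{orbitDist ≤ d_I}`, `d_O + d_I ≤ 1`, `8P₁L³(d_O² + d_I²) < 2`, and the smallness `hH1` of the transport exponent on
the supports, the squared slow-integrated colour-averaged core defect is bounded by `(∫φ²ρ̄)` times the colour-averaged reweighted
central transfers with slow weights polynomial in `orbitDist u`. [cite: Luscher1983, §3] [cite: SjostrandZworski2007, §2] -/
theorem colour_defect_sq_slow_le_orbit_moments {β : ℝ} (hβ1 : 1 ≤ β) {Ω : LinkSpace L → ℝ} (hΩm : Measurable Ω) {CΩ : ℝ}
    (hCΩ : ∀ x, |Ω x| ≤ CΩ) (hΩ0 : ∀ x, 0 ≤ Ω x) {W : (Site 3 L → SU2) → ℝ} (hW : Measurable W) {CW : ℝ} (hCW : ∀ g, |W g| ≤ CW) (hW0 : ∀ g, 0 ≤ W g)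
    {dO dI T Tc R Rin Γ c₂ : ℝ} (hdO : dO ≤ 1 / 2) (hdI : 0 ≤ dI) (hd1 : dO + dI ≤ 1)
    (hσ : 8 * (Fintype.card (Plaquette 3 1) : ℝ) * (L : ℝ) ^ 3 * (dO ^ 2 + dI ^ 2) < 2) (hRinT : Rin ≤ Tc) (hΓ : 0 ≤ Γ)
    (hΩt : ∀ v : Edge 3 L → Fin 3 → ℝ, Ω (linkEmbed L v) ≠ 0 → v ∈ capBalancedSet L ∧ ‖linkEmbed L v‖ ≤ R)
    (hWc : ∀ g : Site 3 L → SU2, W g ≠ 0 → (∀ x, ‖su2Quat (g x) - 1‖ ≤ T) ∧ ‖∑ x, vecPart (g x)‖ ≤ Γ)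
    {P : LinkSpace L → ℝ} (hPinv : ∀ (g : SU2) (x : LinkSpace L), P (adL L g x) = P x) {cq ηc : ℝ} (hcq : 0 ≤ cq) (hP0 : ∀ x, 0 ≤ P x) (hηc : 0 ≤ ηc)
    (hC1 : ∀ v'' : Edge 3 L → Fin 3 → ℝ, v'' ∈ capBalancedSet L → (∀ (e : Edge 3 L) (a : Fin 3), |v'' e a| ≤ Tc) → ‖linkEmbed L v''‖ ≤ Rin →
      |fpFibreTransfer L β Ω W (orthoTube L 1 v'') 1 - cq * P (linkEmbed L v'')| ≤ ηc * (cq * P (linkEmbed L v'')))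
    (hS900 : Rin ^ 2 + R ^ 2 + (Fintype.card (Site 3 L) : ℝ) * T ^ 2 ≤ 1 / 900)
    (hc₂ : 300000000 * ((Fintype.card (Edge 3 L) : ℝ) + (Fintype.card (Plaquette 3 L × Fin 3) : ℝ) + (Fintype.card (Plaquette 3 L) : ℝ)) * (β + β * Real.sqrt β / 2) ≤ c₂)
    (hH1 : 216 * β * (dO + dI) * dO * Γ +
        300000000 * ((Fintype.card (Edge 3 L) : ℝ) + (Fintype.card (Plaquette 3 L × Fin 3) : ℝ) + (Fintype.card (Plaquette 3 L) : ℝ)) *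
            (β * ((4 + Real.sqrt (8 * (Fintype.card (Plaquette 3 1) : ℝ) * (L : ℝ) ^ 3)) * (dO + dI)) + Real.sqrt β / 2) *
          (Rin ^ 2 + R ^ 2 + (Fintype.card (Site 3 L) : ℝ) * T ^ 2) +
        c₂ * (Rin ^ 2 + R ^ 2 + (Fintype.card (Site 3 L) : ℝ) * T ^ 2) ^ 2 ≤ 1)
    (u' : GaugeConfig 3 1 SU2) (hu' : orbitDist u' ≤ dO) {v' : Edge 3 L → Fin 3 → ℝ} (hv' : v' ∈ capBalancedSet L) (hx' : ‖linkEmbed L v'‖ ≤ Rin)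
    {φ : GaugeConfig 3 1 SU2 → ℝ} (hφm : Measurable φ) {Cφ : ℝ} (hφb : ∀ u, |φ u| ≤ Cφ) (hφs : ∀ u, φ u ≠ 0 → orbitDist u ≤ dI) :
    (∫ u, φ u * (∫ c, fpFibreTransfer L β Ω W (gaugeTransform (fun _ : Site 3 L => c⁻¹) (orthoTube L u' v')) u ∂haarProbability SU2) ∂configMeasure SU2 1 -
        cq * P (linkEmbed L v') * ∫ u, φ u * (avgKernel ((L : ℝ) ^ 3 * β) u' u / transferKernel su2Rep ((L : ℝ) ^ 3 * β) (1 : GaugeConfig 3 1 SU2) 1) ∂configMeasure SU2 1) ^ 2 ≤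
      (∫ u, φ u ^ 2 * (avgKernel ((L : ℝ) ^ 3 * β) u' u / transferKernel su2Rep ((L : ℝ) ^ 3 * β) (1 : GaugeConfig 3 1 SU2) 1) ∂configMeasure SU2 1) *
        (40 * (1 + ηc) * (cq * P (linkEmbed L v')) *
            ((∫ u, (216 * β * (orbitDist u' + orbitDist u) * orbitDist u' * Γ +
                    300000000 * ((Fintype.card (Edge 3 L) : ℝ) + (Fintype.card (Plaquette 3 L × Fin 3) : ℝ) + (Fintype.card (Plaquette 3 L) : ℝ)) *
                        (β * ((4 + Real.sqrt (8 * (Fintype.card (Plaquette 3 1) : ℝ) * (L : ℝ) ^ 3)) * (orbitDist u' + orbitDist u)) + Real.sqrt β / 2) * ‖linkEmbed L v'‖ ^ 2 +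
                    3 * c₂ * (‖linkEmbed L v'‖ ^ 2) ^ 2) ^ 2 *
                  (avgKernel ((L : ℝ) ^ 3 * β) u' u / transferKernel su2Rep ((L : ℝ) ^ 3 * β) (1 : GaugeConfig 3 1 SU2) 1) ∂configMeasure SU2 1) *
                ∫ c, fpFibreTransfer L β Ω W (gaugeTransform (fun _ : Site 3 L => c⁻¹) (orthoTube L 1 v')) 1 ∂haarProbability SU2 +
              (∫ u, (300000000 * ((Fintype.card (Edge 3 L) : ℝ) + (Fintype.card (Plaquette 3 L × Fin 3) : ℝ) + (Fintype.card (Plaquette 3 L) : ℝ)) *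
                    (β * ((4 + Real.sqrt (8 * (Fintype.card (Plaquette 3 1) : ℝ) * (L : ℝ) ^ 3)) * (orbitDist u' + orbitDist u)) + Real.sqrt β / 2)) ^ 2 *
                  (avgKernel ((L : ℝ) ^ 3 * β) u' u / transferKernel su2Rep ((L : ℝ) ^ 3 * β) (1 : GaugeConfig 3 1 SU2) 1) ∂configMeasure SU2 1) *
                (∫ c, fpFibreTransfer L β (fun x => Ω x * (‖x‖ ^ 2) ^ 2) W (gaugeTransform (fun _ : Site 3 L => c⁻¹) (orthoTube L 1 v')) 1 ∂haarProbability SU2 +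
                  ∫ c, fpFibreTransfer L β Ω (fun g => W g * (∑ x, ‖su2Quat (g x) - 1‖ ^ 2) ^ 2) (gaugeTransform (fun _ : Site 3 L => c⁻¹) (orthoTube L 1 v')) 1 ∂haarProbability SU2) +
              9 * c₂ ^ 2 * (∫ u, avgKernel ((L : ℝ) ^ 3 * β) u' u / transferKernel su2Rep ((L : ℝ) ^ 3 * β) (1 : GaugeConfig 3 1 SU2) 1 ∂configMeasure SU2 1) *
                (∫ c, fpFibreTransfer L β (fun x => Ω x * (‖x‖ ^ 2) ^ 4) W (gaugeTransform (fun _ : Site 3 L => c⁻¹) (orthoTube L 1 v')) 1 ∂haarProbability SU2 +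
                  ∫ c, fpFibreTransfer L β Ω (fun g => W g * (∑ x, ‖su2Quat (g x) - 1‖ ^ 2) ^ 4) (gaugeTransform (fun _ : Site 3 L => c⁻¹) (orthoTube L 1 v')) 1 ∂haarProbability SU2)) +
          2 * ηc ^ 2 * (cq * P (linkEmbed L v')) ^ 2 *
            ∫ u, avgKernel ((L : ℝ) ^ 3 * β) u' u / transferKernel su2Rep ((L : ℝ) ^ 3 * β) (1 : GaugeConfig 3 1 SU2) 1 ∂configMeasure SU2 1) := by
  haveI : SecondCountableTopology SU2 := secondCountableTopology_su2
  -- names for the constants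
  obtain ⟨K, hK⟩ : ∃ K : ℝ, K = 300000000 * ((Fintype.card (Edge 3 L) : ℝ) + (Fintype.card (Plaquette 3 L × Fin 3) : ℝ) + (Fintype.card (Plaquette 3 L) : ℝ)) := ⟨_, rfl⟩
  obtain ⟨P₁, hP₁⟩ : ∃ P₁ : ℝ, P₁ = 8 * (Fintype.card (Plaquette 3 1) : ℝ) * (L : ℝ) ^ 3 := ⟨_, rfl⟩
  obtain ⟨AL, hAL⟩ : ∃ AL : ℝ, AL = 4 + Real.sqrt (8 * (Fintype.card (Plaquette 3 1) : ℝ) * (L : ℝ) ^ 3) := ⟨_, rfl⟩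
  obtain ⟨S₀, hS₀⟩ : ∃ S₀ : ℝ, S₀ = Rin ^ 2 + R ^ 2 + (Fintype.card (Site 3 L) : ℝ) * T ^ 2 := ⟨_, rfl⟩
  obtain ⟨s', hs'⟩ : ∃ s' : ℝ, s' = ‖linkEmbed L v'‖ ^ 2 := ⟨_, rfl⟩
  obtain ⟨B, hB⟩ : ∃ B : ℝ, B = (L : ℝ) ^ 3 * β := ⟨_, rfl⟩
  obtain ⟨K1, hK1⟩ : ∃ K1 : ℝ, K1 = transferKernel su2Rep ((L : ℝ) ^ 3 * β) (1 : GaugeConfig 3 1 SU2) 1 := ⟨_, rfl⟩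
  obtain ⟨KP, hKP⟩ : ∃ KP : ℝ, KP = cq * P (linkEmbed L v') := ⟨_, rfl⟩
  rw [← hK] at hH1 ⊢; rw [← hAL] at hH1 ⊢; rw [← hS₀] at hH1; rw [← hs', ← hKP]
  have hK0 : 0 ≤ K := by rw [hK]; positivity
  have hP₁0 : 0 ≤ P₁ := by rw [hP₁]; positivity
  have hAL0 : 0 ≤ AL := by rw [hAL]; positivity
  have hS₀0 : 0 ≤ S₀ := by rw [hS₀]; positivity
  have hs'0 : 0 ≤ s' := by rw [hs']; positivity
  have hβ : (0 : ℝ) ≤ β := by linarith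
  have hKP0 : 0 ≤ KP := by rw [hKP]; exact mul_nonneg hcq (hP0 _)
  have hc₂0 : 0 ≤ c₂ := le_trans (mul_nonneg (hK ▸ hK0) (add_nonneg hβ (div_nonneg (mul_nonneg hβ (Real.sqrt_nonneg _)) two_pos.le))) hc₂
  have hdO0 : 0 ≤ dO := (orbitDist_nonneg u').trans hu'
  have hK1p : 0 < K1 := by rw [hK1]; exact transferKernel_pos su2Rep _ _ _
  -- the slow coefficients as functions of `u`
  obtain ⟨c₀f, hc₀f⟩ : ∃ c₀f : GaugeConfig 3 1 SU2 → ℝ, c₀f = fun u => 216 * β * (orbitDist u' + orbitDist u) * orbitDist u' * Γ := ⟨_, rfl⟩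
  obtain ⟨c₁f, hc₁f⟩ : ∃ c₁f : GaugeConfig 3 1 SU2 → ℝ, c₁f = fun u => K * (β * (AL * (orbitDist u' + orbitDist u)) + Real.sqrt β / 2) := ⟨_, rfl⟩
  -- (`positivity`/`gcongr` must not see `orbitDist` atoms: their `whnf` unfolds the `sInf` and times out)
  have h216 : (0 : ℝ) ≤ 216 * β := mul_nonneg (by norm_num) hβ
  have hod0 : ∀ u : GaugeConfig 3 1 SU2, 0 ≤ orbitDist u := fun u => orbitDist_nonneg u
  have hc₀f0 : ∀ u, 0 ≤ c₀f u := fun u => by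
    rw [hc₀f]; exact mul_nonneg (mul_nonneg (mul_nonneg h216 (add_nonneg (hod0 u') (hod0 u))) (hod0 u')) hΓ
  have hc₁f0 : ∀ u, 0 ≤ c₁f u := fun u => by
    rw [hc₁f]; exact mul_nonneg hK0 (add_nonneg (mul_nonneg hβ (mul_nonneg hAL0 (add_nonneg (hod0 u') (hod0 u)))) (div_nonneg (Real.sqrt_nonneg _) two_pos.le))
  have hod12 : ∀ u : GaugeConfig 3 1 SU2, orbitDist u ≤ 4 * (Fintype.card (Edge 3 1) : ℝ) := fun u => orbitDist_le_four_card u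
  have hE0 : (0 : ℝ) ≤ dO + 4 * (Fintype.card (Edge 3 1) : ℝ) := add_nonneg hdO0 (by positivity)
  have hc₀fb : ∀ u, c₀f u ≤ 216 * β * (dO + 4 * (Fintype.card (Edge 3 1) : ℝ)) * dO * Γ := fun u => by
    rw [hc₀f]
    have h1 : orbitDist u' + orbitDist u ≤ dO + 4 * (Fintype.card (Edge 3 1) : ℝ) := add_le_add hu' (hod12 u)
    have h2 : 216 * β * (orbitDist u' + orbitDist u) ≤ 216 * β * (dO + 4 * (Fintype.card (Edge 3 1) : ℝ)) := mul_le_mul_of_nonneg_left h1 h216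
    have h3 : 216 * β * (orbitDist u' + orbitDist u) * orbitDist u' ≤ 216 * β * (dO + 4 * (Fintype.card (Edge 3 1) : ℝ)) * dO :=
      mul_le_mul h2 hu' (hod0 u') (mul_nonneg h216 hE0)
    exact mul_le_mul_of_nonneg_right h3 hΓ
  have hc₁fb : ∀ u, c₁f u ≤ K * (β * (AL * (dO + 4 * (Fintype.card (Edge 3 1) : ℝ))) + Real.sqrt β / 2) := fun u => by
    rw [hc₁f]
    have h1 : orbitDist u' + orbitDist u ≤ dO + 4 * (Fintype.card (Edge 3 1) : ℝ) := add_le_add hu' (hod12 u)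
    exact mul_le_mul_of_nonneg_left (add_le_add (mul_le_mul_of_nonneg_left (mul_le_mul_of_nonneg_left h1 hAL0) hβ) le_rfl) hK0
  -- the slow weights
  obtain ⟨g₀, hg₀⟩ : ∃ g₀ : GaugeConfig 3 1 SU2 → ℝ, g₀ = fun u => (c₀f u + c₁f u * s' + 3 * c₂ * s' ^ 2) ^ 2 := ⟨_, rfl⟩
  obtain ⟨g₁, hg₁⟩ : ∃ g₁ : GaugeConfig 3 1 SU2 → ℝ, g₁ = fun u => c₁f u ^ 2 := ⟨_, rfl⟩
  have hodm : Measurable (orbitDist (L := 1)) := measurable_orbitDist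
  have hc₀fm : Measurable c₀f := by
    rw [hc₀f]; exact (((measurable_const.mul (measurable_const.add hodm)).mul measurable_const).mul measurable_const)
  have hc₁fm : Measurable c₁f := by
    rw [hc₁f]; exact measurable_const.mul ((measurable_const.mul (measurable_const.mul (measurable_const.add hodm))).add measurable_const)
  have hg₀m : Measurable g₀ := by rw [hg₀]; exact ((hc₀fm.add (hc₁fm.mul measurable_const)).add measurable_const).pow_const 2
  have hg₁m : Measurable g₁ := by rw [hg₁]; exact hc₁fm.pow_const 2
  have hg₀0 : ∀ u, 0 ≤ g₀ u := fun u => by rw [hg₀]; exact sq_nonneg _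
  have hg₁0 : ∀ u, 0 ≤ g₁ u := fun u => by rw [hg₁]; exact sq_nonneg _
  obtain ⟨Cg, hCg⟩ : ∃ Cg : ℝ, Cg = (216 * β * (dO + 4 * (Fintype.card (Edge 3 1) : ℝ)) * dO * Γ + K * (β * (AL * (dO + 4 * (Fintype.card (Edge 3 1) : ℝ))) + Real.sqrt β / 2) * s' +
      3 * c₂ * s' ^ 2) ^ 2 + (K * (β * (AL * (dO + 4 * (Fintype.card (Edge 3 1) : ℝ))) + Real.sqrt β / 2)) ^ 2 := ⟨_, rfl⟩
  have hg₀b : ∀ u, g₀ u ≤ Cg := fun u => by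
    rw [hg₀, hCg]; dsimp only
    have h1 : (c₀f u + c₁f u * s' + 3 * c₂ * s' ^ 2) ^ 2 ≤ (216 * β * (dO + 4 * (Fintype.card (Edge 3 1) : ℝ)) * dO * Γ +
        K * (β * (AL * (dO + 4 * (Fintype.card (Edge 3 1) : ℝ))) + Real.sqrt β / 2) * s' + 3 * c₂ * s' ^ 2) ^ 2 := by
      have ha : 0 ≤ c₀f u + c₁f u * s' + 3 * c₂ * s' ^ 2 :=
        add_nonneg (add_nonneg (hc₀f0 u) (mul_nonneg (hc₁f0 u) hs'0)) (mul_nonneg (mul_nonneg (by norm_num) hc₂0) (sq_nonneg _))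
      have hb : c₀f u + c₁f u * s' + 3 * c₂ * s' ^ 2 ≤ 216 * β * (dO + 4 * (Fintype.card (Edge 3 1) : ℝ)) * dO * Γ +
          K * (β * (AL * (dO + 4 * (Fintype.card (Edge 3 1) : ℝ))) + Real.sqrt β / 2) * s' + 3 * c₂ * s' ^ 2 := by
        have := hc₀fb u; have := mul_le_mul_of_nonneg_right (hc₁fb u) hs'0; linarith
      exact pow_le_pow_left₀ ha hb 2
    linarith [sq_nonneg (K * (β * (AL * (dO + 4 * (Fintype.card (Edge 3 1) : ℝ))) + Real.sqrt β / 2))]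
  have hg₁b : ∀ u, g₁ u ≤ Cg := fun u => by
    rw [hg₁, hCg]; dsimp only
    have h1 : c₁f u ^ 2 ≤ (K * (β * (AL * (dO + 4 * (Fintype.card (Edge 3 1) : ℝ))) + Real.sqrt β / 2)) ^ 2 := pow_le_pow_left₀ (hc₁f0 u) (hc₁fb u) 2
    linarith [sq_nonneg (216 * β * (dO + 4 * (Fintype.card (Edge 3 1) : ℝ)) * dO * Γ + K * (β * (AL * (dO + 4 * (Fintype.card (Edge 3 1) : ℝ))) + Real.sqrt β / 2) * s' +
      3 * c₂ * s' ^ 2)]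
  have hg₀i : ∀ (h : Site 3 1 → SU2) (u : GaugeConfig 3 1 SU2), g₀ (gaugeTransform h u) = g₀ u := fun h u => by
    rw [hg₀, hc₀f, hc₁f]; simp only [orbitDist_gaugeTransform]
  have hg₁i : ∀ (h : Site 3 1 → SU2) (u : GaugeConfig 3 1 SU2), g₁ (gaugeTransform h u) = g₁ u := fun h u => by
    rw [hg₁, hc₁f]; simp only [orbitDist_gaugeTransform]
  -- the reweighted profiles / weights and the colour-averaged central transfers
  have hΩR : ∀ x : LinkSpace L, Ω x ≠ 0 → ‖x‖ ≤ R := fun x hx => by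
    have h := (hΩt (linkCurry x) (by rwa [linkEmbed_linkCurry])).2
    rwa [linkEmbed_linkCurry] at h
  have hR0 : Ω ≠ 0 → 0 ≤ R := fun h => by
    obtain ⟨x, hx⟩ := Function.ne_iff.mp h
    exact (norm_nonneg _).trans (hΩR x hx)
  have hΩkm : ∀ k : ℕ, Measurable fun x : LinkSpace L => Ω x * (‖x‖ ^ 2) ^ k := fun k => hΩm.mul ((measurable_norm.pow_const 2).pow_const k)
  have hΩk0 : ∀ (k : ℕ) (x : LinkSpace L), 0 ≤ Ω x * (‖x‖ ^ 2) ^ k := fun k x => mul_nonneg (hΩ0 x) (by positivity)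
  have hΩkb : ∀ (k : ℕ) (x : LinkSpace L), |Ω x * (‖x‖ ^ 2) ^ k| ≤ CΩ * (R ^ 2) ^ k := fun k x => by
    have hCΩ0 : 0 ≤ CΩ := (abs_nonneg _).trans (hCΩ 0)
    by_cases hx : Ω x = 0
    · rw [hx, zero_mul, abs_zero]; positivity
    · rw [abs_mul, abs_of_nonneg (by positivity : (0 : ℝ) ≤ (‖x‖ ^ 2) ^ k)]
      exact mul_le_mul (hCΩ x) (pow_le_pow_left₀ (sq_nonneg _) (pow_le_pow_left₀ (norm_nonneg _) (hΩR x hx) 2) k) (by positivity) hCΩ0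
  have hWjm : ∀ j : ℕ, Measurable fun g : Site 3 L → SU2 => W g * (∑ x, ‖su2Quat (g x) - 1‖ ^ 2) ^ j := fun j => hW.mul (measurable_gaugeDevSq.pow_const j)
  have hWj0 : ∀ (j : ℕ) (g : Site 3 L → SU2), 0 ≤ W g * (∑ x, ‖su2Quat (g x) - 1‖ ^ 2) ^ j := fun j g => mul_nonneg (hW0 g) (pow_nonneg (gaugeDevSq_mem g).1 j)
  have hWjb : ∀ (j : ℕ) (g : Site 3 L → SU2), |W g * (∑ x, ‖su2Quat (g x) - 1‖ ^ 2) ^ j| ≤ CW * (4 * Fintype.card (Site 3 L)) ^ j := fun j g => by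
    have hCW0 : 0 ≤ CW := (abs_nonneg _).trans (hCW 1)
    rw [abs_mul, abs_of_nonneg (pow_nonneg (gaugeDevSq_mem g).1 j)]
    exact mul_le_mul (hCW g) (pow_le_pow_left₀ (gaugeDevSq_mem g).1 (gaugeDevSq_mem g).2 j) (pow_nonneg (gaugeDevSq_mem g).1 j) hCW0
  obtain ⟨T₀, hT₀⟩ : ∃ T₀ : SU2 → ℝ, T₀ = fun c => fpFibreTransfer L β Ω W (gaugeTransform (fun _ : Site 3 L => c⁻¹) (orthoTube L 1 v')) 1 := ⟨_, rfl⟩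
  obtain ⟨T₁, hT₁⟩ : ∃ T₁ : SU2 → ℝ, T₁ = fun c => fpFibreTransfer L β (fun x => Ω x * (‖x‖ ^ 2) ^ 2) W (gaugeTransform (fun _ : Site 3 L => c⁻¹) (orthoTube L 1 v')) 1 := ⟨_, rfl⟩
  obtain ⟨T₂, hT₂⟩ : ∃ T₂ : SU2 → ℝ, T₂ = fun c => fpFibreTransfer L β Ω (fun g => W g * (∑ x, ‖su2Quat (g x) - 1‖ ^ 2) ^ 2) (gaugeTransform (fun _ : Site 3 L => c⁻¹) (orthoTube L 1 v')) 1 :=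
    ⟨_, rfl⟩
  obtain ⟨T₃, hT₃⟩ : ∃ T₃ : SU2 → ℝ, T₃ = fun c => fpFibreTransfer L β (fun x => Ω x * (‖x‖ ^ 2) ^ 4) W (gaugeTransform (fun _ : Site 3 L => c⁻¹) (orthoTube L 1 v')) 1 := ⟨_, rfl⟩
  obtain ⟨T₄, hT₄⟩ : ∃ T₄ : SU2 → ℝ, T₄ = fun c => fpFibreTransfer L β Ω (fun g => W g * (∑ x, ‖su2Quat (g x) - 1‖ ^ 2) ^ 4) (gaugeTransform (fun _ : Site 3 L => c⁻¹) (orthoTube L 1 v')) 1 :=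
    ⟨_, rfl⟩
  have hT₀m : Measurable T₀ := by rw [hT₀]; exact measurable_fpFibreTransfer_conj β hΩm hW _ _
  have hT₁m : Measurable T₁ := by rw [hT₁]; exact measurable_fpFibreTransfer_conj β (hΩkm 2) hW _ _
  have hT₂m : Measurable T₂ := by rw [hT₂]; exact measurable_fpFibreTransfer_conj β hΩm (hWjm 2) _ _
  have hT₃m : Measurable T₃ := by rw [hT₃]; exact measurable_fpFibreTransfer_conj β (hΩkm 4) hW _ _
  have hT₄m : Measurable T₄ := by rw [hT₄]; exact measurable_fpFibreTransfer_conj β hΩm (hWjm 4) _ _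
  have hT₀0 : ∀ c, 0 ≤ T₀ c := fun c => by rw [hT₀]; exact fpFibreTransfer_nonneg β hΩ0 hW0 _ _
  have hT₁0 : ∀ c, 0 ≤ T₁ c := fun c => by rw [hT₁]; exact fpFibreTransfer_nonneg β (hΩk0 2) hW0 _ _
  have hT₂0 : ∀ c, 0 ≤ T₂ c := fun c => by rw [hT₂]; exact fpFibreTransfer_nonneg β hΩ0 (hWj0 2) _ _
  have hT₃0 : ∀ c, 0 ≤ T₃ c := fun c => by rw [hT₃]; exact fpFibreTransfer_nonneg β (hΩk0 4) hW0 _ _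
  have hT₄0 : ∀ c, 0 ≤ T₄ c := fun c => by rw [hT₄]; exact fpFibreTransfer_nonneg β hΩ0 (hWj0 4) _ _
  obtain ⟨B₀, hB₀⟩ := abs_fpFibreTransfer_le' (L := L) β hCΩ hCW
  obtain ⟨B₁, hB₁⟩ := abs_fpFibreTransfer_le' (L := L) β (hΩkb 2) hCW
  obtain ⟨B₂, hB₂⟩ := abs_fpFibreTransfer_le' (L := L) β hCΩ (hWjb 2)
  obtain ⟨B₃, hB₃⟩ := abs_fpFibreTransfer_le' (L := L) β (hΩkb 4) hCW
  obtain ⟨B₄, hB₄⟩ := abs_fpFibreTransfer_le' (L := L) β hCΩ (hWjb 4)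
  obtain ⟨CT, hCT⟩ : ∃ CT : ℝ, CT = |B₀| + |B₁| + |B₂| + |B₃| + |B₄| := ⟨_, rfl⟩
  have hTb : ∀ {Tm : SU2 → ℝ} {Bm : ℝ}, (∀ c, |Tm c| ≤ Bm) → |Bm| ≤ CT → ∀ c, Tm c ≤ CT := fun h1 h2 c =>
    (le_abs_self _).trans ((h1 c).trans ((le_abs_self _).trans h2))
  have hT₀b : ∀ c, T₀ c ≤ CT := hTb (fun c => by rw [hT₀]; exact hB₀ _ _) (by rw [hCT]; linarith [abs_nonneg B₁, abs_nonneg B₂, abs_nonneg B₃, abs_nonneg B₄])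
  have hT₁b : ∀ c, T₁ c ≤ CT := hTb (fun c => by rw [hT₁]; exact hB₁ _ _) (by rw [hCT]; linarith [abs_nonneg B₀, abs_nonneg B₂, abs_nonneg B₃, abs_nonneg B₄])
  have hT₂b : ∀ c, T₂ c ≤ CT := hTb (fun c => by rw [hT₂]; exact hB₂ _ _) (by rw [hCT]; linarith [abs_nonneg B₀, abs_nonneg B₁, abs_nonneg B₃, abs_nonneg B₄])
  have hT₃b : ∀ c, T₃ c ≤ CT := hTb (fun c => by rw [hT₃]; exact hB₃ _ _) (by rw [hCT]; linarith [abs_nonneg B₀, abs_nonneg B₁, abs_nonneg B₂, abs_nonneg B₄])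
  have hT₄b : ∀ c, T₄ c ≤ CT := hTb (fun c => by rw [hT₄]; exact hB₄ _ _) (by rw [hCT]; linarith [abs_nonneg B₀, abs_nonneg B₁, abs_nonneg B₂, abs_nonneg B₃])
  -- the colour-averaged fibre transfer `I` and its recentred version `Ĩ`
  obtain ⟨ρ, hρ⟩ : ∃ ρ : GaugeConfig 3 1 SU2 → ℝ, ρ = fun u => avgKernel B u' u / K1 := ⟨_, rfl⟩
  have hρm : Measurable ρ := by rw [hρ]; exact (measurable_avgKernel_right B u').div_const _
  have hρ0 : ∀ u, 0 ≤ ρ u := fun u => by rw [hρ]; exact div_nonneg (avgKernel_pos B u' u).le hK1p.le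
  obtain ⟨M, hM⟩ := exists_transferKernel_le su2Rep continuous_su2Rep B (L := 1)
  have hρb : ∀ u, ρ u ≤ M / K1 := fun u => by rw [hρ]; exact div_le_div_of_nonneg_right (avgKernel_le B hM u' u) hK1p.le
  obtain ⟨I, hI⟩ : ∃ I : GaugeConfig 3 1 SU2 → ℝ, I = fun u => ∫ c, fpFibreTransfer L β Ω W (gaugeTransform (fun _ : Site 3 L => c⁻¹) (orthoTube L u' v')) u ∂haarProbability SU2 :=
    ⟨_, rfl⟩
  have hIm : Measurable I := by rw [hI]; exact measurable_colour_fpFibreTransfer β hΩm hW _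
  have hIb : ∀ u, |I u| ≤ |B₀| := fun u => by
    rw [hI]; dsimp only
    have h := norm_integral_le_of_norm_le_const (μ := haarProbability SU2)
      (f := fun c : SU2 => fpFibreTransfer L β Ω W (gaugeTransform (fun _ : Site 3 L => c⁻¹) (orthoTube L u' v')) u) (C := |B₀|)
      (Filter.Eventually.of_forall fun c => by rw [Real.norm_eq_abs]; exact (hB₀ _ _).trans (le_abs_self _))
    rwa [probReal_univ, mul_one, Real.norm_eq_abs] at h
  obtain ⟨It, hIt⟩ : ∃ It : GaugeConfig 3 1 SU2 → ℝ, It = fun u => if φ u = 0 then KP * ρ u else I u := ⟨_, rfl⟩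
  have hItm : Measurable It := by
    rw [hIt]; exact Measurable.ite (hφm (measurableSet_singleton 0)) (hρm.const_mul KP) hIm
  have hItb : ∀ u, |It u| ≤ |B₀| + KP * (M / K1) := fun u => by
    rw [hIt]; dsimp only
    have h2 : 0 ≤ KP * (M / K1) := mul_nonneg hKP0 ((hρ0 u).trans (hρb u))
    split_ifs with h
    · rw [abs_of_nonneg (mul_nonneg hKP0 (hρ0 u))]
      have := mul_le_mul_of_nonneg_left (hρb u) hKP0; linarith [abs_nonneg B₀]
    · linarith [hIb u]
  have hφI : ∀ u, φ u * It u = φ u * I u := fun u => by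
    rw [hIt]; dsimp only
    split_ifs with h
    · rw [h, zero_mul, zero_mul]
    · rfl
  -- the pointwise bound, on and off the support of `φ`
  have hY0 : ∀ {Tm : SU2 → ℝ}, (∀ c, 0 ≤ Tm c) → ∀ u : GaugeConfig 3 1 SU2,
      0 ≤ ∫ c, transferKernel su2Rep B (gaugeTransform (fun _ : Site 3 1 => c⁻¹) u') u / transferKernel su2Rep B (1 : GaugeConfig 3 1 SU2) 1 * Tm c ∂haarProbability SU2 :=
    fun hTm u => integral_nonneg fun c => mul_nonneg (div_nonneg (transferKernel_pos su2Rep _ _ _).le (transferKernel_pos su2Rep _ _ _).le) (hTm c)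
  have hpt : ∀ u, (It u - KP * (avgKernel B u' u / transferKernel su2Rep B (1 : GaugeConfig 3 1 SU2) 1)) ^ 2 ≤
      40 * (1 + ηc) * (KP * (avgKernel B u' u / transferKernel su2Rep B (1 : GaugeConfig 3 1 SU2) 1)) *
          (g₀ u * ∫ c, transferKernel su2Rep B (gaugeTransform (fun _ : Site 3 1 => c⁻¹) u') u / transferKernel su2Rep B (1 : GaugeConfig 3 1 SU2) 1 * T₀ c ∂haarProbability SU2 +
            g₁ u * (∫ c, transferKernel su2Rep B (gaugeTransform (fun _ : Site 3 1 => c⁻¹) u') u / transferKernel su2Rep B (1 : GaugeConfig 3 1 SU2) 1 * T₁ c ∂haarProbability SU2 +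
                ∫ c, transferKernel su2Rep B (gaugeTransform (fun _ : Site 3 1 => c⁻¹) u') u / transferKernel su2Rep B (1 : GaugeConfig 3 1 SU2) 1 * T₂ c ∂haarProbability SU2) +
            9 * c₂ ^ 2 * (∫ c, transferKernel su2Rep B (gaugeTransform (fun _ : Site 3 1 => c⁻¹) u') u / transferKernel su2Rep B (1 : GaugeConfig 3 1 SU2) 1 * T₃ c ∂haarProbability SU2 +
                ∫ c, transferKernel su2Rep B (gaugeTransform (fun _ : Site 3 1 => c⁻¹) u') u / transferKernel su2Rep B (1 : GaugeConfig 3 1 SU2) 1 * T₄ c ∂haarProbability SU2)) +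
        2 * ηc ^ 2 * (KP * (avgKernel B u' u / transferKernel su2Rep B (1 : GaugeConfig 3 1 SU2) 1)) ^ 2 := fun u => by
    by_cases hφu : φ u = 0
    · -- off the support: the recentred integrand sits at its centre
      have hc : It u = KP * (avgKernel B u' u / transferKernel su2Rep B (1 : GaugeConfig 3 1 SU2) 1) := by
        rw [hIt]; dsimp only; rw [if_pos hφu, hρ, hK1, hB]
      rw [hc, sub_self, zero_pow two_ne_zero]
      have hKρ : 0 ≤ KP * (avgKernel B u' u / transferKernel su2Rep B (1 : GaugeConfig 3 1 SU2) 1) :=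
        mul_nonneg hKP0 (div_nonneg (avgKernel_pos B u' u).le (transferKernel_pos su2Rep _ _ _).le)
      have h40 : (0 : ℝ) ≤ 40 * (1 + ηc) := mul_nonneg (by norm_num) (by linarith)
      exact add_nonneg (mul_nonneg (mul_nonneg h40 hKρ) (add_nonneg (add_nonneg (mul_nonneg (hg₀0 u) (hY0 hT₀0 u))
        (mul_nonneg (hg₁0 u) (add_nonneg (hY0 hT₁0 u) (hY0 hT₂0 u)))) (mul_nonneg (mul_nonneg (by norm_num) (sq_nonneg c₂)) (add_nonneg (hY0 hT₃0 u) (hY0 hT₄0 u)))))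
        (mul_nonneg (mul_nonneg two_pos.le (sq_nonneg ηc)) (sq_nonneg _))
    · -- on the support: the pointwise Cauchy–Schwarz defect with orbit-distance windows
      have hdu : orbitDist u ≤ dI := hφs u hφu
      have hd0 : 0 ≤ orbitDist u := orbitDist_nonneg u
      have hd'0 : 0 ≤ orbitDist u' := orbitDist_nonneg u'
      have hδ1 : orbitDist u' ≤ 1 / 2 := hu'.trans hdO
      have hα1 : orbitDist u' + orbitDist u ≤ 1 := by linarith
      have hσu : P₁ * (orbitDist u' ^ 2 + orbitDist u ^ 2) < 2 := by
        have h1 : orbitDist u' ^ 2 ≤ dO ^ 2 := pow_le_pow_left₀ hd'0 hu' 2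
        have h2 : orbitDist u ^ 2 ≤ dI ^ 2 := pow_le_pow_left₀ hd0 hdu 2
        have h3 : P₁ * (orbitDist u' ^ 2 + orbitDist u ^ 2) ≤ P₁ * (dO ^ 2 + dI ^ 2) := mul_le_mul_of_nonneg_left (by linarith) hP₁0
        rw [hP₁] at h3 ⊢; linarith
      have hSw : ∀ w : GaugeConfig 3 1 SU2, (L : ℝ) ^ 3 * wilsonAction su2Rep w ≤ P₁ * orbitDist w ^ 2 := fun w => by
        have h := wilsonAction_le_of_orbitDist_le (le_refl (orbitDist w))
        rw [hP₁]
        calc (L : ℝ) ^ 3 * wilsonAction su2Rep w ≤ (L : ℝ) ^ 3 * (8 * orbitDist w ^ 2 * Fintype.card (Plaquette 3 1)) :=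
              mul_le_mul_of_nonneg_left h (by positivity)
          _ = 8 * (Fintype.card (Plaquette 3 1) : ℝ) * (L : ℝ) ^ 3 * orbitDist w ^ 2 := by ring
      have hS' : (L : ℝ) ^ 3 * wilsonAction su2Rep u' ≤ P₁ * (orbitDist u' ^ 2 + orbitDist u ^ 2) :=
        (hSw u').trans (by rw [mul_add]; exact le_add_of_nonneg_right (mul_nonneg hP₁0 (sq_nonneg _)))
      have hS : (L : ℝ) ^ 3 * wilsonAction su2Rep u ≤ P₁ * (orbitDist u' ^ 2 + orbitDist u ^ 2) :=
        (hSw u).trans (by rw [mul_add]; exact le_add_of_nonneg_left (mul_nonneg hP₁0 (sq_nonneg _)))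
      have hu'q : ∀ k : Fin 3, ‖su2Quat (u' (0, k)) - 1‖ ≤ orbitDist u' := fun k => norm_su2Quat_sub_one_le_orbitDist u' (0, k)
      have huq : ∀ k : Fin 3, ‖su2Quat (u (0, k)) - 1‖ ≤ orbitDist u := fun k => norm_su2Quat_sub_one_le_orbitDist u (0, k)
      have hc₀u : 216 * β * (orbitDist u' + orbitDist u) * orbitDist u' * Γ ≤ c₀f u := by rw [hc₀f]
      have hc₁u : K * (β * ((orbitDist u' + orbitDist u) + orbitDist u' + (orbitDist u' + orbitDist u) ^ 2 + orbitDist u' ^ 2 +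
          Real.sqrt (P₁ * (orbitDist u' ^ 2 + orbitDist u ^ 2))) + Real.sqrt β / 2) ≤ c₁f u := by
        rw [hc₁f]; dsimp only
        have hw := window_sum_le (P := P₁) hd'0 hδ1 hd0 hα1 hP₁0
        have hw' : (orbitDist u' + orbitDist u) + orbitDist u' + (orbitDist u' + orbitDist u) ^ 2 + orbitDist u' ^ 2 +
            Real.sqrt (P₁ * (orbitDist u' ^ 2 + orbitDist u ^ 2)) ≤ AL * (orbitDist u' + orbitDist u) := by rw [hAL, ← hP₁]; exact hw
        have h2 := mul_le_mul_of_nonneg_left hw' hβ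
        exact mul_le_mul_of_nonneg_left (by linarith) hK0
      have hH1u : c₀f u + c₁f u * S₀ + c₂ * S₀ ^ 2 ≤ 1 := by
        have ha : orbitDist u' + orbitDist u ≤ dO + dI := add_le_add hu' hdu
        have h1 : c₀f u ≤ 216 * β * (dO + dI) * dO * Γ := by
          rw [hc₀f]
          have h2 : 216 * β * (orbitDist u' + orbitDist u) ≤ 216 * β * (dO + dI) := mul_le_mul_of_nonneg_left ha h216
          have h3 : 216 * β * (orbitDist u' + orbitDist u) * orbitDist u' ≤ 216 * β * (dO + dI) * dO :=
            mul_le_mul h2 hu' hd'0 (mul_nonneg h216 (add_nonneg hdO0 hdI))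
          exact mul_le_mul_of_nonneg_right h3 hΓ
        have h2 : c₁f u ≤ K * (β * (AL * (dO + dI)) + Real.sqrt β / 2) := by
          rw [hc₁f]
          exact mul_le_mul_of_nonneg_left (add_le_add (mul_le_mul_of_nonneg_left (mul_le_mul_of_nonneg_left ha hAL0) hβ) le_rfl) hK0
        have h3 := mul_le_mul_of_nonneg_right h2 hS₀0
        linarith
      have H5 := colour_fpFibreTransfer_defect_sq_le_moments (L := L) hβ1 hΩm hCΩ hΩ0 hW hCW hW0 (δ := orbitDist u') (δu := orbitDist u) (T := T) (Tc := Tc)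
        (R := R) (Rin := Rin) (Γ := Γ) (σ := P₁ * (orbitDist u' ^ 2 + orbitDist u ^ 2)) (c₀ := c₀f u) (c₁ := c₁f u) (c₂ := c₂) hδ1 hα1 hσu hRinT hΩt hWc
        hPinv hcq hP0 hηc hC1 hS900 hc₀u (by rw [hK] at hc₁u; exact hc₁u) hc₂ (hc₀f0 u)
        (by rw [hS₀] at hH1u; exact hH1u) u' u hu'q hS' huq hS hv' hx'
      have hc : It u = I u := by rw [hIt]; dsimp only; rw [if_neg hφu]
      rw [hc, hI, hg₀, hg₁, hT₀, hT₁, hT₂, hT₃, hT₄, hKP, hB, hs']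
      exact H5
  -- the slow integration
  have key := sq_slow_defect_le_colour_moments B hφm hItm hφb hItb u' hT₀m hT₁m hT₂m hT₃m hT₄m hT₀0 hT₁0 hT₂0 hT₃0 hT₄0 hT₀b hT₁b hT₂b hT₃b hT₄b
    hg₀m hg₁m hg₀0 hg₁0 hg₀b hg₁b hg₀i hg₁i (g₂ := 9 * c₂ ^ 2) (by positivity) (A := 40 * (1 + ηc)) (E := 2 * ηc ^ 2) hKP0 hpt
  have hIeq : ∫ u, φ u * It u ∂configMeasure SU2 1 = ∫ u, φ u * I u ∂configMeasure SU2 1 := integral_congr_ae (ae_of_all _ hφI)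
  rw [hIeq, hI, hg₀, hg₁, hT₀, hT₁, hT₂, hT₃, hT₄, hB] at key
  rw [hc₀f, hc₁f] at key
  beta_reduce at key
  exact key

end Summit.QuantumFields.YangMills.Theorems.FemtoTransferGap.TwoLattice.ConstTube

end
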